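import Summits.HubbardSuperconductivity.HubbardSuperconductivity.Theorems.KLProgrammeKLRegimeScaleZeroCovarianceOffSiteWindow
import Summits.HubbardSuperconductivity.HubbardSuperconductivity.Theorems.KLProgrammeScaleZeroCovarianceMomentumJetsTab
import Literature.MathematicalPhysics.QuantumLattice.HubbardMatsubaraShellRowSum

/-!
# Route `KLProgramme`, crux K3 — engine-flow child (stmt-HubbardSuperconductivity-20437), stub (C) at `n = 0`, located item #22a «(C)-SCALE0-PT2»,
# §2a (M)/(L) with the TREE'S NUMERALS: the off-site window-truncation and frequency-sum bounds, and the `O(1/m(ω)²)` bare-frame jets, hypothesis-free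

Cell gate-hubbard-kl, seat p1 g20.  `…ScaleZeroCovarianceOffSiteWindow` (the (M) layer) and `…ScaleZeroCovarianceMomentumJets` §6 (the `O(1/m(ω)²)` jets) carry
three table hypotheses: `|χ₂′| ≤ B₁`, the band bound `|e(k)| ≤ E`, and the flat cutoff table `|χ₂^{(i)}| ≤ B` (`i ≤ n`).  The tree supplies all three:
`klsh_abs_deriv_salmhoferCutoff_le` (`B₁ = 8/3`, sharp; `…SalmhoferCutoffSecondDerivSharp`), `abs_nambuXiCT_le` (`E = 4 + |μ| + ‖K‖₀`, every frame `K`;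
`HubbardMatsubaraShellRowSum`), and p2 g18's proved table `klChi2CauchyTab` (`…SalmhoferCutoffDerivTableRecord`, `salmhoferCutoff_flat_cauchy_table_deriv`).
With them, for the engine's band `e = nambuXiCT L μ K` and every frame `K`:

* **`norm_freqTerm_nambuXiCT_le_of_ne_zero`** — `‖(βL²)⁻²e^{iωΔτ}Σ_k χ_k(x)Ψ(ω, e_K(k))‖ ≤ (19/3)(4+|μ|+‖K‖₀)/(β·m(ω)²)` off site;
* **`norm_sum_freqTerm_nambuXiCT_sub_tsum_le_of_ne_zero`** — (M): the `2M`-frequency window differs from the full series by `≤ (19/3)(4+|μ|+‖K‖₀)·β/(2π²M)`;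
* **`tsum_norm_freqTerm_nambuXiCT_le_of_ne_zero`** — the full off-site frequency series is absolutely convergent, `≤ (19/3)(4+|μ|+‖K‖₀)·(2/Λ)`, uniformly in `β, L`;
* `norm_iteratedFDeriv_uvSpatialSymbol_bare_le_of_one_le_tab`, **`norm_torusFourierInv_uvSpatialSample_sub_kernel_le_bare_sq_tab`**,
  **`norm_torusFourierInv_uvSpatialSample_le_inv_pow_offSite_bare_sq_tab`** — the `O(1/m(ω)²)` bare-frame jets and §2a (L) clauses with `B := klChi2CauchyTab n`.

Proofs only; no definitions; nothing here asserts (C), any stub of 20437, K3 or superconductivity.  References: BGM 2006 §2.1 (2.3)–(2.6a), (2.36aa)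
[cite: BenfattoGiulianiMastropietro2006]; Salmhofer 1999 §4.2.4 (4.63), §4.2.5 (4.70)–(4.71) [cite: Salmhofer1999].
-/

noncomputable section

namespace Summit.HubbardSuperconductivity.HubbardSuperconductivity.Theorems.KLRegimeSplit

set_option linter.dupNamespace false -- summit = problem name (single-conjunct summit), D-0017

open Literature.MathematicalPhysics.QuantumLattice Literature.Probability.LatticeModels Literature.Analysis.FunctionSpaces
open Summit.HubbardSuperconductivity.HubbardSuperconductivity.Theorems.DispersionFlow
open Finset Complex UnitAddTorus Real
open scoped Nat

variable {L : ℕ} [NeZero L]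

/-! ## §1 The (M) layer for the engine's band `e_K = nambuXiCT L μ K`, numerals of the tree -/

/-- **Off-site frequency term of the scale-`0` covariance, explicit**: for `x ≠ 0`, `0 < β`, `0 < Λ`, every frame `K` and all real `ω`, `Δτ`:
`‖(βL²)⁻²·e^{iωΔτ}·Σ_k χ_k(x)Ψ(ω, e_K(k))‖ ≤ (19/3)·(4+|μ|+‖K‖₀)/(β·m(ω)²)` (`B₁ = 8/3`, `E = 4+|μ|+‖K‖₀`). -/
theorem norm_freqTerm_nambuXiCT_le_of_ne_zero {Λ : ℝ} (hΛ : 0 < Λ) {β : ℝ} (hβ : 0 < β) (μ : ℝ) (K : TrigPolyC4v) (ω Δτ : ℝ)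
    {x : TorusSite 2 L} (hx : x ≠ 0) :
    ‖((1 / (β * (L : ℝ) ^ 2) : ℝ) : ℂ) ^ 2 * cexp (I * ((ω * Δτ : ℝ) : ℂ)) *
        ∑ k, torusChar k x * uvSymbolFn (β * (L : ℝ) ^ 2) Λ (nambuXiCT L μ K k) ω‖ ≤ (19 / 3) * (4 + |μ| + K.coeffNorm 0) / (β * max |ω| (Λ / 2) ^ 2) := by
  have h := norm_freqTerm_le_of_ne_zero hΛ klsh_abs_deriv_salmhoferCutoff_le hβ (nambuXiCT L μ K) (abs_nambuXiCT_le μ K) ω Δτ hx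
  norm_num at h ⊢
  exact h

/-- **(M) explicit**: for `x ≠ 0`, `0 < β`, `0 < Λ`, `1 ≤ M`, every frame `K` and every real `Δτ`, the `2M`-frequency window of the off-site entry differs
from the full Matsubara series by at most `(19/3)·(4+|μ|+‖K‖₀)·β/(2π²M)`, and the full series converges absolutely. -/
theorem norm_sum_freqTerm_nambuXiCT_sub_tsum_le_of_ne_zero {Λ : ℝ} (hΛ : 0 < Λ) {β : ℝ} (hβ : 0 < β) {M : ℕ} (hM : 0 < M) (μ : ℝ) (K : TrigPolyC4v)
    (Δτ : ℝ) {x : TorusSite 2 L} (hx : x ≠ 0) :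
    Summable (fun n : ℤ => ((1 / (β * (L : ℝ) ^ 2) : ℝ) : ℂ) ^ 2 * cexp (I * (((2 * n + 1) * π / β * Δτ : ℝ) : ℂ)) *
        ∑ k, torusChar k x * uvSymbolFn (β * (L : ℝ) ^ 2) Λ (nambuXiCT L μ K k) ((2 * n + 1) * π / β)) ∧
    ‖∑ i : MatsubaraIdx M, ((1 / (β * (L : ℝ) ^ 2) : ℝ) : ℂ) ^ 2 * cexp (I * ((matsubaraFreq β M i * Δτ : ℝ) : ℂ)) *
          ∑ k, torusChar k x * uvSymbolFn (β * (L : ℝ) ^ 2) Λ (nambuXiCT L μ K k) (matsubaraFreq β M i) -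
        ∑' n : ℤ, ((1 / (β * (L : ℝ) ^ 2) : ℝ) : ℂ) ^ 2 * cexp (I * (((2 * n + 1) * π / β * Δτ : ℝ) : ℂ)) *
          ∑ k, torusChar k x * uvSymbolFn (β * (L : ℝ) ^ 2) Λ (nambuXiCT L μ K k) ((2 * n + 1) * π / β)‖ ≤
      (19 / 3) * (4 + |μ| + K.coeffNorm 0) * β / (2 * π ^ 2 * M) := by
  have h := norm_sum_freqTerm_sub_tsum_le_of_ne_zero hΛ klsh_abs_deriv_salmhoferCutoff_le hβ hM (nambuXiCT L μ K) (abs_nambuXiCT_le μ K) Δτ hx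
  norm_num at h ⊢
  exact h

/-- **The full off-site frequency series, explicit and uniform in `β`, `L`**: for `x ≠ 0`, `0 < β`, `0 < Λ`, every frame `K`, every real `Δτ`:
`Σ_{n∈ℤ} ‖(βL²)⁻²e^{iω_nΔτ}Σ_k χ_k(x)Ψ(ω_n, e_K(k))‖ ≤ (19/3)·(4+|μ|+‖K‖₀)·(2/Λ)`. -/
theorem tsum_norm_freqTerm_nambuXiCT_le_of_ne_zero {Λ : ℝ} (hΛ : 0 < Λ) {β : ℝ} (hβ : 0 < β) (μ : ℝ) (K : TrigPolyC4v) (Δτ : ℝ)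
    {x : TorusSite 2 L} (hx : x ≠ 0) :
    Summable (fun n : ℤ => ‖((1 / (β * (L : ℝ) ^ 2) : ℝ) : ℂ) ^ 2 * cexp (I * (((2 * n + 1) * π / β * Δτ : ℝ) : ℂ)) *
        ∑ k, torusChar k x * uvSymbolFn (β * (L : ℝ) ^ 2) Λ (nambuXiCT L μ K k) ((2 * n + 1) * π / β)‖) ∧
    ∑' n : ℤ, ‖((1 / (β * (L : ℝ) ^ 2) : ℝ) : ℂ) ^ 2 * cexp (I * (((2 * n + 1) * π / β * Δτ : ℝ) : ℂ)) *
        ∑ k, torusChar k x * uvSymbolFn (β * (L : ℝ) ^ 2) Λ (nambuXiCT L μ K k) ((2 * n + 1) * π / β)‖ ≤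
      (19 / 3) * (4 + |μ| + K.coeffNorm 0) * (2 / Λ) := by
  have h := tsum_norm_freqTerm_le_of_ne_zero hΛ klsh_abs_deriv_salmhoferCutoff_le hβ (nambuXiCT L μ K) (abs_nambuXiCT_le μ K) Δτ hx
  norm_num at h ⊢
  exact h

/-! ## §2 The `O(1/m(ω)²)` bare-frame jets and §2a (L) clauses with the proved cutoff table `klChi2CauchyTab` -/

/-- **Bare-frame momentum jets of size `O(1/m(ω)²)`, table-free**: for `n ≥ 1`,
`‖Dⁿ g_ω(y)‖ ≤ n!·(c·klChi2CauchyTab n·(n+1)!·(2/m)²·max(1,2/m)^{n−1})·(8π)ⁿ` at `K = 0`. -/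
theorem norm_iteratedFDeriv_uvSpatialSymbol_bare_le_of_one_le_tab {c Λ : ℝ} (hc : 0 ≤ c) (hΛ : 0 < Λ) (μ : ℝ) (om : ℝ) {n : ℕ} (hn1 : 1 ≤ n)
    (y : Momentum) :
    ‖iteratedFDeriv ℝ n (fun y : Momentum => uvSymbolFn c Λ (frameLevel μ 0 ((2 * π) • y)) om) y‖ ≤
      n ! * (c * klChi2CauchyTab n * (n + 1) ! * (2 / max |om| (Λ / 2)) ^ 2 * (max 1 (2 / max |om| (Λ / 2))) ^ (n - 1)) * ((2 * π) * 4) ^ n :=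
  norm_iteratedFDeriv_uvSpatialSymbol_bare_le_of_one_le hc hΛ μ om hn1 (one_le_klChi2CauchyTab n) (salmhoferCutoff_flat_cauchy_table_deriv n) y

/-- **Torus comparison at the bare frame with the `O(1/m(ω)²)` constant, table-free** (`0 ≤ c`, `0 < Λ`, `ω ≠ 0`, `n ≥ 4`, every box radius `R`,
every `L ≥ R + 1 + Σ|z_j|`). -/
theorem norm_torusFourierInv_uvSpatialSample_sub_kernel_le_bare_sq_tab {c Λ : ℝ} (hc : 0 ≤ c) (hΛ : 0 < Λ) (μ : ℝ) {om : ℝ} (hom : om ≠ 0)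
    {n : ℕ} (hn : 2 * 2 ≤ n) {R : ℕ} (z : Site 2) (hR : (R : ℤ) + 1 + ∑ i, |z i| ≤ L) :
    ‖torusFourierInv (fun kv : TorusSite 2 L =>
          (fun y : Momentum => uvSymbolFn c Λ (frameLevel μ 0 ((2 * π) • y)) om) (WithLp.toLp 2 fun i => ((kv i).val : ℝ) / L))
          (Torus.proj L z) -
        mFourierCoeff (Torus.descend (fun y : Momentum => uvSymbolFn c Λ (frameLevel μ 0 ((2 * π) • y)) om)
          (uvSpatialSymbol_isLatticePeriodic c Λ μ 0 om)) (-z)‖ ≤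
      (n ! * (c * klChi2CauchyTab n * (n + 1) ! * (2 / max |om| (Λ / 2)) ^ 2 * (max 1 (2 / max |om| (Λ / 2))) ^ (n - 1)) * ((2 * π) * 4) ^ n) /
          (2 * Real.pi) ^ n * (2 / ((2 * R + 2 : ℕ) : ℝ)) ^ (n - 2 * 2) * (2 ^ 2 * ∑' k : Site 2, ∏ j, (1 + (k j : ℝ) ^ 2)⁻¹) :=
  norm_torusFourierInv_uvSpatialSample_sub_kernel_le_bare_sq hc hΛ μ hom hn (one_le_klChi2CauchyTab n) (salmhoferCutoff_flat_cauchy_table_deriv n) z hR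

/-- **Off-site L-uniform decay at the bare frame with the `O(1/m(ω)²)` constant, table-free** (centred off-site `z`, `2‖z‖ ≤ L`, `n ≥ 4`). -/
theorem norm_torusFourierInv_uvSpatialSample_le_inv_pow_offSite_bare_sq_tab {c Λ : ℝ} (hc : 0 ≤ c) (hΛ : 0 < Λ) (μ : ℝ) {om : ℝ} (hom : om ≠ 0)
    {n : ℕ} (hn : 2 * 2 ≤ n) {z : Site 2} (hz : 2 * ‖z‖ ≤ L) (hz0 : Torus.proj L z ≠ 0) :
    ‖torusFourierInv (fun kv : TorusSite 2 L =>
          (fun y : Momentum => uvSymbolFn c Λ (frameLevel μ 0 ((2 * π) • y)) om) (WithLp.toLp 2 fun i => ((kv i).val : ℝ) / L))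
          (Torus.proj L z)‖ ≤
      ((n ! * (c * klChi2CauchyTab n * (n + 1) ! * (2 / max |om| (Λ / 2)) ^ 2 * (max 1 (2 / max |om| (Λ / 2))) ^ (n - 1)) * ((2 * π) * 4) ^ n) /
          Real.pi ^ n) * (1 + (4 : ℝ) ^ n * ∑' k : Site 2, ((1 + ‖k‖) ^ n)⁻¹) * ((1 + ‖z‖) ^ n)⁻¹ :=
  norm_torusFourierInv_uvSpatialSample_le_inv_pow_offSite_bare_sq hc hΛ μ hom hn (one_le_klChi2CauchyTab n) (salmhoferCutoff_flat_cauchy_table_deriv n) hz hz0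

end Summit.HubbardSuperconductivity.HubbardSuperconductivity.Theorems.KLRegimeSplit

end
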